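import Summits.BirchSwinnertonDyer.BirchSwinnertonDyer.Theses.PAdicOrderV2
import Literature.NumberTheory.EllipticCurves.PAdicGrossZagier
import Literature.Barriers.BirchSwinnertonDyer.PAdicFunctionalEquationParity
import Literature.NumberTheory.EllipticCurves.PAdicLFunctionInterpolationHoldsProofs
import Literature.NumberTheory.EllipticCurves.PAdicLFunctionNeZeroHoldsProofs
import Literature.NumberTheory.EllipticCurves.SupersingularDensitySerreFrobeniusProofs
import Summits.BirchSwinnertonDyer.BirchSwinnertonDyer.Theorems.PAdicOrderV2PAdicOrderComparisonR2StubParity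
import Summits.BirchSwinnertonDyer.BirchSwinnertonDyer.Theorems.PAdicOrderV2PAdicOrderRankOneR4OneLeOrder

/-!
# Disproof of `PAdicOrderRankOneR4` (stmt-BirchSwinnertonDyer-0515) — findings

Crux (route `PAdicOrderV2`, rank 5; verbatim, `crux_iff` below is `Iff.rfl`):
for `W/ℚ` elliptic and globally minimal, `p` prime with `IsOrdinaryAt W p` (good ordinary),
`W.analyticRank = 1`, and `f ∈ S₂(Γ₀(N))` with `IsNewformOf W f`:
`(padicLFunction f (unitRoot W p)).order = 1` — the Mazur–Swinnerton-Dyer `p`-adic `L`-function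
`L_p(E,T)` has a SIMPLE zero at `T = 0` (all good ordinary `p`, `p = 2, 3` included).

## Verdict of this cycle: NO KILL — the crux is rank-one Schneider non-degeneracy in disguise

* `≥ 1` is a theorem of the tree (interpolation `constantCoeff_padicLFunction_unitRoot` +
  `L(E,1) = 0`); `≤ 1` ⟺ `L_p'(E,0) ≠ 0` ⟺ (Perrin-Riou 1987 Thm 1.3 + Gross–Zagier–Kolyvagin + a
  rank-0 twist, `p ≥ 5` split in a Heegner field) the canonical cyclotomic `p`-adic height of the
  generator is non-zero = Schneider's conjecture in rank one: OPEN for non-CM curves, PROVED for CM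
  curves (Bertrand 1982, `p`-adic transcendence), and never observed to fail (p-adic regulators of
  all rank-1 curves in Cremona/LMFDB ranges at good ordinary `5 ≤ p < 100` are non-zero to working
  precision; Stein–Wuthrich 2013 §§8–9; Wuthrich 2004 for families). Section §3 makes the reduction
  formal INSIDE the tree: `height_ne_zero_of_crux` — the crux implies (modulo the tree fact
  `perrinRiou_padicGrossZagier`) the non-vanishing of the canonical height of every Heegner point in
  Perrin-Riou's setting. A counterexample must moreover have `ord_T L_p ≥ 3` (p-adic functional
  equation: `ord_T ≡ r_an (mod 2)`, barrier `PAdicFunctionalEquationSeesOnlyParity`).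
* Cheapest falsifier run this cycle (kit jobs j016547, j016704; evidence on the item): all 166
  isogeny classes of analytic rank one with `N ≤ 330`, every good ordinary `p ∈ {2,3,5,7}` — `p = 2, 3`
  being the only primes of the crux NOT covered by published `p`-adic regulator tables (Sage/LMFDB
  heights need `p ≥ 5`): 351 pairs `(E,p)` (27 at `p = 2`, 75 at `p = 3`), and in EVERY pair
  `L_p(E,0) = 0`, `L_p'(E,0) ≠ 0`, i.e. `ord_T L_p = 1` as the crux predicts (valuations of the
  `T`-coefficient `c₁`: `p = 3`: 1–3 (one `5`); `p = 2`: 0–4). TOOLING PITFALL recorded for later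
  seats: PARI/GP 2.15.4 `ellpadicL` / `mspadicmoments` return ZERO to working precision (`O(2^k)` for
  every derivative) at `p = 2` whenever `a_2 = +1` (unit root `α ≡ 3 mod 4`) — for rank-0 curves too —
  which j016547 first flagged as five "order ≥ 3 candidates" (`N = 185, 249, 277, 285, 297`); j016704
  recomputed `c₀, c₁, c₂, c₃` INDEPENDENTLY by the tree's own recipe (exact plus symbols `mseval`,
  MSD measure, Riemann sums over `±5^s mod 2^{n+2}`, `n = 5,7,9`, stable digits) and found `c₀ = 0`,
  `c₁ ≠ 0` (valuations 2,2,0,0,1) for all five, and reproduced the interpolation value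
  `(1-α⁻¹)²·L(E,1)/Ω⁺` exactly on four rank-0 controls where PARI again printed `O(2^7)`. So: no
  counterexample, and PARI's `p = 2` output must not be trusted when `a_2 = +1`.
* No junk escape: every tree object on the crux's range is honest (`unitRoot` is the Hensel unit
  root incl. `p = 2`: disc `a₂² - 8 ≡ 1 (mod 8)`; `cyclotomicGenerator 2 = 5`, `torsionOrder 2 = 2`;
  `ratPlusSymbol` is Manin–Drinfeld-rational for the newform; `limUnder` is a true limit for the
  unit root). The junk regimes lie exactly OFF the hypotheses and are recorded in §1–§2 as
  load-bearing lemmas: off the ordinary locus `unitRoot = 0` and the tree's `L_p` is the ZERO series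
  (`order = ⊤`), and for `f = 0` (no `IsNewformOf`) likewise — so `IsOrdinaryAt` and `IsNewformOf`
  cannot be weakened, for ANY curve (unconditional theorems `order_ne_one_of_dvd_frobeniusTrace`,
  `order_padicLFunction_zero_form`). `analyticRank = 1` cannot be dropped: at a good ordinary `p`,
  `order = 0 ↔ [0]⁺_f ≠ 0` (`order_eq_zero_iff_ratPlusSymbol_ne_zero`, from the DISCHARGED
  interpolation theorem and Hasse's bound `α ≠ 1`).
* An UNCONDITIONAL `¬ PAdicOrderRankOneR4` is out of reach of the tree for a structural reason worth
  stating to provers: every instance of the hypotheses needs a `CuspForm (Gamma0 N) 2` with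
  `IsNewformOf W f` (modularity, not constructible) and a certificate `W.analyticRank = 1` (needs
  `hasEntireLFunction_rat`); so refutations can only be `H → ¬ crux` with `H` an existence statement.

## Landed / proposed under `Theorems/PAdicOrderRankOneR4/Negative/` (this seat)
* `JunkRegime.lean` (p99365): §1–§2 below, pointwise and unconditional (`order = ⊤ ≠ 1` off the
  ordinary locus and for the zero form).
* `CounterexampleShape.lean` (p100960): in analytic rank one at ANY good ordinary `p` the order is
  finite and ODD (tree parity theorem `stub_even_order_iff_even_analyticRank` + Rohrlich), so
  `order ≠ 1 ↔ 3 ≤ order`, `order = 1 ↔ coeff 1 ≠ 0`, `¬ crux ↔ ∃ rank-one (W,p,f) with 3 ≤ order`;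
  and `height_ne_zero_of_PAdicOrderRankOneR4` (crux ⟹ rank-one Schneider for Heegner points, mod PR87).

## Line `Sketch` (= idea tame-shadow-derived-kato), stub attack (§4, on the v1 stubs) — two stubs were
## MISSTATED; the lead's v2 skeleton (2026-08-16, after wave 1) has since repaired both (`c₁ < m`)
* K2 `stub_shadowNonconstancy` is TRIVIALLY TRUE: take `d = d₀`, `m = 0`; `ZMod (p^0)` is a
  subsingleton, so `¬ (p^c₁ ∣ V₀)` is unsatisfiable and the `∀ V₀ V₁` clause is vacuous
  (`K2_trivial`). It carries no content as typed.
* K1 `stub_shadowIdentity` has an UNSATISFIABLE conclusion (its `∀ m` includes `m = 0`, where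
  `¬ (p^c₁ ∣ u₀w₀)` fails), hence K1 ⟺ "main range ∧ r_an = 1 ⟹ ¬ 2 ≤ ord_T L_p" — K1 IS the
  crux('s open half) on the main range (`K1_iff_upperHalf`). Repair for both: quantify `m` over
  `c₁ < m` (K1: `∀ m, c₁ < m → ∃ u w …`; K2: `∃ m, c₁ < m ∧ ∀ V₀ V₁ …`).
* Even repaired, K1's identity `c·t·t(ι) + u·b·w(ι) + ι²R = X²S` is equivalent (by the lead's own P1
  computation plus `X² ∣` anything with vanishing coefficients 0,1) to the bare proportionality
  `u₀w₀ · b₁(ℓ) = b₀(ℓ) · (u₀w₁ - u₁w₀)` for an `ℓ`-independent pair — `t, R, S, c, ι` are decoration;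
  K1 ∧ K2 is literally `Φ ∧ ¬Φ`-shaped modus tollens, so all content sits in WHICH of K1/K2 is true,
  and nothing in the tree can presently decide either (both quantify over `tameMixedCoeff`, limits of
  plus symbols of an unconstructible newform).
* P1 `stub_mixedCoeff` is TRUE (checked by hand: X¹-coefficient), S1 is provable from tree theorems,
  K3 `stub_residual` is the crux off the main range (as hard as the crux; includes `p ∈ {2,3}`).

Index: §0 restatement · §1 junk regime `α = 0`, `f = 0` · §2 load-bearing hypotheses ·
§3 consequences / strengthenings (height, parity) · §4 line `Sketch` stubs · §5 near-misses.
-/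

set_option linter.unusedVariables false
set_option linter.unusedSectionVars false
set_option linter.dupNamespace false

noncomputable section

namespace Summit.BirchSwinnertonDyer.BirchSwinnertonDyer.Cruxes.PAdicOrderRankOneR4.Disproof

open CongruenceSubgroup PowerSeries Filter Topology NumberField
open Summit.BirchSwinnertonDyer.BirchSwinnertonDyer.Theses.PAdicOrderV2
open Literature.NumberTheory.EllipticCurves Literature.NumberTheory.EllipticCurves.ModularForms
open Literature.Barriers.BirchSwinnertonDyer

/-! ## §0 The crux, unfolded -/

/-- The crux with every binder visible (definitional unfolding). -/
theorem crux_iff :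
    PAdicOrderRankOneR4 ↔
      ∀ (W : WeierstrassCurve ℚ) [W.IsElliptic] [W.IsGloballyMinimal] (p : ℕ) [Fact p.Prime],
        IsOrdinaryAt W p → W.analyticRank = 1 →
        ∀ {N : ℕ} [NeZero N] (f : CuspForm (Gamma0 N) 2), IsNewformOf W f →
          (padicLFunction f (unitRoot W p : ℚ_[p])).order = 1 :=
  Iff.rfl

/-! ## §1 Junk regimes of the tree objects

Two degenerate inputs make the tree's `L_p` the ZERO power series (order `⊤`): the root `α = 0`
(the junk value of `unitRoot` off the ordinary locus) and the zero cusp form. -/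

section Junk

variable {N : ℕ} (f : CuspForm (Gamma0 N) 2) {p : ℕ} [Fact p.Prime]

/-- At positive level the Mazur–Swinnerton-Dyer measure for the junk root `α = 0` vanishes
(`0⁻¹ = 0`, `0^(n+1) = 0`). [folklore] -/
theorem msdMeasure_zero_root_succ (n : ℕ) (a : ZMod (p ^ (n + 1))) :
    msdMeasure f (0 : ℚ_[p]) (n + 1) a = 0 := by
  simp [msdMeasure]

/-- Same, for any level `m > 0`. [folklore] -/
theorem msdMeasure_zero_root_of_pos : ∀ {m : ℕ}, 0 < m → ∀ a : ZMod (p ^ m),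
    msdMeasure f (0 : ℚ_[p]) m a = 0
  | 0, h, _ => absurd h (lt_irrefl 0)
  | m + 1, _, a => msdMeasure_zero_root_succ f m a

omit [Fact p.Prime] in
/-- `e₀ ≥ 1`. [folklore] -/
theorem cyclotomicExponent_pos (p : ℕ) [Fact p.Prime] : 0 < cyclotomicExponent p := by
  unfold cyclotomicExponent; split <;> norm_num

/-- Every Riemann sum for the junk root vanishes (the measure is sampled at level `n + e₀ ≥ 1`).
[folklore] -/
theorem padicLRiemannSum_zero_root (k n : ℕ) : padicLRiemannSum f (0 : ℚ_[p]) k n = 0 := by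
  unfold padicLRiemannSum
  have hpos : 0 < n + cyclotomicExponent p := by
    have := cyclotomicExponent_pos p; omega
  simp [msdMeasure_zero_root_of_pos f hpos]

/-- Hence every coefficient of `L_p(f, 0, T)` is `0` (`limUnder` of the constant sequence `0`).
[folklore] -/
theorem padicLCoeff_zero_root (k : ℕ) : padicLCoeff f (0 : ℚ_[p]) k = 0 := by
  unfold padicLCoeff
  have h : padicLRiemannSum f (0 : ℚ_[p]) k = fun _ => 0 :=
    funext (padicLRiemannSum_zero_root f k)
  rw [h]
  exact tendsto_const_nhds.limUnder_eq

/-- **`L_p(f, 0, T) = 0`**: the tree's `p`-adic `L`-function at the junk root is the zero series.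
[folklore] -/
theorem padicLFunction_zero_root : padicLFunction f (0 : ℚ_[p]) = 0 := by
  ext k
  simp [padicLCoeff_zero_root]

/-- **Off the ordinary locus the unit root is the junk value `0`**: if `p ∣ a_p` then
`X² - a_p X + p` has no unit root in `ℤ_p` (a root `α` has `α² = a_p α - p ∈ pℤ_p`), so the
`dite` in `unitRoot` takes its `else` branch. [folklore] -/
theorem unitRoot_eq_zero_of_dvd (W : WeierstrassCurve ℚ) [W.IsGloballyMinimal] (p : ℕ)
    [Fact p.Prime] (h : (p : ℤ) ∣ W.frobeniusTrace p) : unitRoot W p = 0 := by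
  unfold unitRoot
  rw [dif_neg]
  rintro ⟨α, ⟨hα, hu⟩, -⟩
  have hαn : ‖α‖ = 1 := PadicInt.isUnit_iff.mp hu
  have ha : ‖(W.frobeniusTrace p : ℤ_[p])‖ < 1 := (PadicInt.norm_int_lt_one_iff_dvd _).mpr h
  have hp : ‖(p : ℤ_[p])‖ < 1 := by
    rw [PadicInt.norm_p]
    exact inv_lt_one_of_one_lt₀ (by exact_mod_cast (Fact.out : p.Prime).one_lt)
  have h2 : α ^ 2 = (W.frobeniusTrace p : ℤ_[p]) * α + -(p : ℤ_[p]) := by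
    linear_combination hα
  have hlt : ‖α ^ 2‖ < 1 := by
    rw [h2]
    refine (PadicInt.nonarchimedean _ _).trans_lt (max_lt ?_ ?_)
    · rw [norm_mul, hαn, mul_one]; exact ha
    · rwa [norm_neg]
  rw [norm_pow, hαn, one_pow] at hlt
  exact lt_irrefl _ hlt

/-- **Order `⊤` off the ordinary locus.** For EVERY Weierstrass curve, EVERY prime `p ∣ a_p` (good
supersingular, or additive) and EVERY weight-2 cusp form, the tree's `L_p` is the zero series.
[folklore] -/
theorem order_padicLFunction_of_dvd (W : WeierstrassCurve ℚ) [W.IsGloballyMinimal] (p : ℕ)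
    [Fact p.Prime] (h : (p : ℤ) ∣ W.frobeniusTrace p) (f : CuspForm (Gamma0 N) 2) :
    (padicLFunction f (unitRoot W p : ℚ_[p])).order = ⊤ := by
  rw [unitRoot_eq_zero_of_dvd W p h, PadicInt.coe_zero, padicLFunction_zero_root, order_zero]

/-- The zero cusp form has zero modular symbols. [folklore] -/
theorem modularSymbol_zero_form (r : ℚ) : modularSymbol (0 : CuspForm (Gamma0 N) 2) r = 0 := by
  simp [modularSymbol]

/-- … hence zero rational plus symbols (the `dite` picks some `q : ℚ` with `(q : ℝ) = 0`). [folklore] -/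
theorem ratPlusSymbol_zero_form (r : ℚ) : ratPlusSymbol (0 : CuspForm (Gamma0 N) 2) r = 0 := by
  have h0 : normalizedPlusSymbol (0 : CuspForm (Gamma0 N) 2) r = 0 := by
    simp [normalizedPlusSymbol, plusSymbol, modularSymbol_zero_form]
  unfold ratPlusSymbol
  split_ifs with h
  · have h1 : ((h.choose : ℚ) : ℝ) = 0 := h.choose_spec.trans h0
    exact_mod_cast h1
  · rfl

/-- … hence the zero measure, at every level and for every root. [folklore] -/
theorem msdMeasure_zero_form (α : ℚ_[p]) : ∀ (m : ℕ) (a : ZMod (p ^ m)),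
    msdMeasure (0 : CuspForm (Gamma0 N) 2) α m a = 0
  | 0, a => by simp [msdMeasure, ratPlusSymbol_zero_form]
  | m + 1, a => by simp [msdMeasure, ratPlusSymbol_zero_form]

/-- … hence `L_p(0, α, T) = 0`. [folklore] -/
theorem padicLFunction_zero_form (α : ℚ_[p]) : padicLFunction (0 : CuspForm (Gamma0 N) 2) α = 0 := by
  ext k
  simp only [coeff_padicLFunction, map_zero]
  unfold padicLCoeff
  have h : padicLRiemannSum (0 : CuspForm (Gamma0 N) 2) α k = fun _ => 0 := by
    funext n
    unfold padicLRiemannSum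
    simp [msdMeasure_zero_form]
  rw [h]
  exact tendsto_const_nhds.limUnder_eq

/-- **Order `⊤` for the zero form**, whatever the curve and the prime. [folklore] -/
theorem order_padicLFunction_zero_form (α : ℚ_[p]) :
    (padicLFunction (0 : CuspForm (Gamma0 N) 2) α).order = ⊤ := by
  rw [padicLFunction_zero_form, order_zero]

end Junk

/-! ## §2 Load-bearing hypotheses

For each hypothesis of the crux: what breaks when it is dropped. (H1) `IsOrdinaryAt` and
(H4) `IsNewformOf` are load-bearing UNCONDITIONALLY and UNIFORMLY (the conclusion is false at
every instance of the weakened hypothesis, by §1); (H2) `analyticRank = 1` is load-bearing through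
the discharged interpolation theorem; (H3) `IsGloballyMinimal` is needed to even state `a_p`
(typeclass argument of `IsOrdinaryAt`/`unitRoot`), so it cannot be dropped syntactically. -/

section LoadBearing

/-- (H1) The crux with ordinarity weakened to GOOD REDUCTION (supersingular primes admitted). -/
def WithoutOrdinary : Prop :=
  ∀ (W : WeierstrassCurve ℚ) [W.IsElliptic] [W.IsGloballyMinimal] (p : ℕ) [Fact p.Prime],
    W.HasGoodReductionAtPrime p → W.analyticRank = 1 →
    ∀ {N : ℕ} [NeZero N] (f : CuspForm (Gamma0 N) 2), IsNewformOf W f →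
      (padicLFunction f (unitRoot W p : ℚ_[p])).order = 1

/-- (H1, unconditional pointwise form) **any proof must use ordinarity**: at a prime `p ∣ a_p` the
conclusion of the crux is FALSE for every curve and every form (the tree's `L_p` is `0` there — at a
genuinely supersingular prime the honest object would be Pollack's `L_p^±`/an unbounded
distribution, which the tree deliberately does not define). [folklore] -/
theorem order_ne_one_of_dvd_frobeniusTrace (W : WeierstrassCurve ℚ) [W.IsGloballyMinimal]
    (p : ℕ) [Fact p.Prime] (h : (p : ℤ) ∣ W.frobeniusTrace p) {N : ℕ}
    (f : CuspForm (Gamma0 N) 2) : (padicLFunction f (unitRoot W p : ℚ_[p])).order ≠ 1 := by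
  rw [order_padicLFunction_of_dvd W p h f]
  exact ENat.top_ne_coe 1

/-- `H_ss`: some modular elliptic curve of analytic rank one has a good SUPERSINGULAR prime. True in
nature (`37a1 = [0,0,1,-1,0]`: `r_an = 1`, `a_2 = -2`, `a_3 = -3`, both good supersingular), but not
constructible in the tree: it needs a `CuspForm` with `IsNewformOf` (modularity) and a certificate
`analyticRank = 1` (entire continuation + `L(E,1) = 0 ≠ L'(E,1)`). -/
def ExistsRankOneGoodSupersingular : Prop :=
  ∃ (W : WeierstrassCurve ℚ) (_ : W.IsElliptic) (_ : W.IsGloballyMinimal) (p : ℕ) (_ : Fact p.Prime),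
    W.HasGoodReductionAtPrime p ∧ (p : ℤ) ∣ W.frobeniusTrace p ∧ W.analyticRank = 1 ∧
    ∃ (N : ℕ) (_ : NeZero N) (f : CuspForm (Gamma0 N) 2), IsNewformOf W f

/-- (H1) `WithoutOrdinary` is false as soon as `H_ss` is witnessed. [folklore] -/
theorem withoutOrdinary_false_of (hH : ExistsRankOneGoodSupersingular) : ¬ WithoutOrdinary := by
  obtain ⟨W, hE, hM, p, hp, hgood, hdvd, hr, N, hN, f, hf⟩ := hH
  intro h
  exact order_ne_one_of_dvd_frobeniusTrace W p hdvd f (h W p hgood hr f hf)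

/-- (H4) The crux with `IsNewformOf W f` dropped (any weight-2 cusp form of any level). -/
def WithoutNewform : Prop :=
  ∀ (W : WeierstrassCurve ℚ) [W.IsElliptic] [W.IsGloballyMinimal] (p : ℕ) [Fact p.Prime],
    IsOrdinaryAt W p → W.analyticRank = 1 →
    ∀ {N : ℕ} [NeZero N] (f : CuspForm (Gamma0 N) 2),
      (padicLFunction f (unitRoot W p : ℚ_[p])).order = 1

/-- `H_rk1`: some elliptic curve of analytic rank one has a good ordinary prime (true in nature:
`37a1` at `p = 5`, `a_5 = -2`; not constructible: the `analyticRank = 1` certificate). -/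
def ExistsRankOneOrdinary : Prop :=
  ∃ (W : WeierstrassCurve ℚ) (_ : W.IsElliptic) (_ : W.IsGloballyMinimal) (p : ℕ) (_ : Fact p.Prime),
    IsOrdinaryAt W p ∧ W.analyticRank = 1

/-- (H4) **any proof must use `IsNewformOf`**: the zero form (level 1) kills the conclusion for every
`(W, p)`; so `WithoutNewform` is false as soon as `H_rk1` is witnessed. [folklore] -/
theorem withoutNewform_false_of (hH : ExistsRankOneOrdinary) : ¬ WithoutNewform := by
  obtain ⟨W, hE, hM, p, hp, hord, hr⟩ := hH
  intro h
  have h1 := h W p hord hr (N := 1) (0 : CuspForm (Gamma0 1) 2)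
  rw [order_padicLFunction_zero_form] at h1
  exact ENat.top_ne_coe 1 h1

/-- (H2, ingredient) **`α ≠ 1` at a good ordinary prime**: `α = 1` would force `a_p = p + 1`
(`unitRoot_spec_holds`: `α² - a_p α + p = 0`), against Hasse `a_p² ≤ 4p`
(`WeierstrassCurve.frobeniusTrace_sq_le_four_mul`). So the Euler factor `(1 - α⁻¹)²` of the
interpolation formula never vanishes at a GOOD ORDINARY prime (no "exceptional zero" there).
[folklore] -/
theorem unitRoot_ne_one (W : WeierstrassCurve ℚ) [W.IsElliptic] [W.IsGloballyMinimal] (p : ℕ)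
    [Fact p.Prime] (hord : IsOrdinaryAt W p) : (unitRoot W p : ℚ_[p]) ≠ 1 := by
  intro h1
  have hα : unitRoot W p = 1 := Subtype.ext h1
  have hspec := (unitRoot_spec_holds W p hord).1
  rw [hα] at hspec
  have hcast : ((W.frobeniusTrace p : ℤ) : ℤ_[p]) = ((p + 1 : ℤ) : ℤ_[p]) := by
    push_cast; linear_combination -hspec
  have ha : W.frobeniusTrace p = p + 1 := by exact_mod_cast hcast
  have hH := W.frobeniusTrace_sq_le_four_mul p hord.1
  rw [ha] at hH
  have hp2 : (2 : ℤ) ≤ p := by exact_mod_cast (Fact.out : p.Prime).two_le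
  nlinarith

/-- (H2) **At a good ordinary prime, `ord_T L_p(E,T) = 0 ↔ [0]⁺_f ≠ 0`** (`[0]⁺_f = L(E,1)/Ω⁺_f`),
from the DISCHARGED interpolation theorem `isPAdicLFunctionOf_padicLFunction_holds`
(`L_p(E,0) = (1 - α⁻¹)² [0]⁺_f`) and `α ≠ 1`. Hence dropping `analyticRank = 1` from the crux is
fatal at every curve with `L(E,1) ≠ 0` (analytic rank `0`: `order = 0 ≠ 1`); a witness needs a
newform, so the closed form is again only `H → ¬`. [folklore] -/
theorem order_eq_zero_iff_ratPlusSymbol_ne_zero (W : WeierstrassCurve ℚ) [W.IsElliptic]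
    [W.IsGloballyMinimal] (p : ℕ) [Fact p.Prime] (hord : IsOrdinaryAt W p) {N : ℕ} [NeZero N]
    {f : CuspForm (Gamma0 N) 2} (hf : IsNewformOf W f) :
    (padicLFunction f (unitRoot W p : ℚ_[p])).order = 0 ↔ ratPlusSymbol f 0 ≠ 0 := by
  have hc : constantCoeff (padicLFunction f (unitRoot W p : ℚ_[p])) =
      (1 - (unitRoot W p : ℚ_[p])⁻¹) ^ 2 * (ratPlusSymbol f 0 : ℚ_[p]) :=
    (isPAdicLFunctionOf_padicLFunction_holds (f := f) (p := p) (W := W) hord hf).1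
  have hE : (1 - (unitRoot W p : ℚ_[p])⁻¹) ^ 2 ≠ 0 := by
    refine pow_ne_zero 2 (sub_ne_zero.mpr ?_)
    intro h
    exact unitRoot_ne_one W p hord (inv_eq_one.mp h.symm)
  rw [show (0 : ℕ∞) = ((0 : ℕ) : ℕ∞) from rfl, order_eq_nat]
  simp only [Nat.not_lt_zero, IsEmpty.forall_iff, implies_true, and_true,
    coeff_zero_eq_constantCoeff, hc, mul_ne_zero_iff, Rat.cast_ne_zero]
  exact ⟨fun h => h.2, fun h => ⟨hE, h⟩⟩

/-- (H2) The crux with `W.analyticRank = 1` dropped. -/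
def WithoutRankOne : Prop :=
  ∀ (W : WeierstrassCurve ℚ) [W.IsElliptic] [W.IsGloballyMinimal] (p : ℕ) [Fact p.Prime],
    IsOrdinaryAt W p →
    ∀ {N : ℕ} [NeZero N] (f : CuspForm (Gamma0 N) 2), IsNewformOf W f →
      (padicLFunction f (unitRoot W p : ℚ_[p])).order = 1

/-- `H_rk0`: some modular curve with `[0]⁺_f ≠ 0` (i.e. `L(E,1) ≠ 0`) at a good ordinary prime
(true in nature: `11a1`, `p = 3`, `a_3 = -1`, `L(E,1)/Ω = 1/5`; needs a newform: not constructible). -/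
def ExistsRankZeroOrdinary : Prop :=
  ∃ (W : WeierstrassCurve ℚ) (_ : W.IsElliptic) (_ : W.IsGloballyMinimal) (p : ℕ) (_ : Fact p.Prime),
    IsOrdinaryAt W p ∧ ∃ (N : ℕ) (_ : NeZero N) (f : CuspForm (Gamma0 N) 2),
      IsNewformOf W f ∧ ratPlusSymbol f 0 ≠ 0

/-- (H2) `WithoutRankOne` is false as soon as `H_rk0` is witnessed. [folklore] -/
theorem withoutRankOne_false_of (hH : ExistsRankZeroOrdinary) : ¬ WithoutRankOne := by
  obtain ⟨W, hE, hM, p, hp, hord, N, hN, f, hf, h0⟩ := hH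
  intro h
  have h1 := h W p hord f hf
  have h0' := (order_eq_zero_iff_ratPlusSymbol_ne_zero W p hord hf).mpr h0
  rw [h0'] at h1
  exact zero_ne_one h1

end LoadBearing

/-! ## §3 Consequences and the shape of a counterexample

(3a) The crux IMPLIES rank-one Schneider non-degeneracy for Heegner points (modulo the tree fact
`perrinRiou_padicGrossZagier`, Perrin-Riou 1987 Thm 1.3): this is the barrier
`PAdicHeightBarrier` read in the crux's direction, and it is why the crux is open — a proof of the
crux at one split ordinary `p ≥ 5` is a proof that `⟨P_K,P_K⟩_p ≠ 0`.
(3b) Conversely a COUNTEREXAMPLE `(E,p)` to the crux is exactly a rank-one curve with a degenerate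
canonical `p`-adic height (`crux_false_of_degenerateHeegnerDatum`), and by the `p`-adic functional
equation it must have `ord_T L_p(E,T) ≥ 3` (`three_le_order_of_counterexample`). -/

section Consequences

variable {W : WeierstrassCurve ℚ} [W.IsElliptic] [W.IsGloballyMinimal] {p : ℕ} [Fact p.Prime]
  {K : Type} [Field K] [NumberField K] {N : ℕ} [NeZero N]
  {Nf Ng : ℕ} [NeZero Nf] [NeZero Ng] {f : CuspForm (Gamma0 Nf) 2} {g : CuspForm (Gamma0 Ng) 2}

/-- (3a) **Crux ⟹ non-vanishing of the canonical `p`-adic height of Heegner points.** In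
Perrin-Riou's setting (`p ≥ 5` good ordinary and split in the Heegner field `K`, odd `d_K` coprime
to `N = N_E`, canonical height datum `DK`, Heegner point `P = P_K`), if `E` has analytic rank one
and the twist factor `L_p(E^{(d_K)},T)` is a unit (`order = 0`, i.e. `L(E^{(d_K)},1) ≠ 0` — the
standard choice of `K`), then the crux forces `⟨P_K, P_K⟩_p ≠ 0`: `ord L_p(E/K) = ord L_p(E) +
ord L_p(E^D) = 1 + 0`, and Perrin-Riou's `order_eq_one_iff`. [cite: PerrinRiou1987, Thm. 1.3] -/
theorem height_ne_zero_of_crux (hcrux : PAdicOrderRankOneR4) (h : perrinRiou_padicGrossZagier)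
    (hf : IsNewformOf W f) (hg : IsNewformOf (W.quadraticTwist (NumberField.discr K : ℚ)) g)
    (hp : 5 ≤ p) (hgood : W.HasGoodReductionAtPrime p) (hord : ¬ (p : ℤ) ∣ W.frobeniusTrace p)
    (hK : IsImaginaryQuadratic K) (hodd : Odd (NumberField.discr K))
    (hcop : IsCoprime (NumberField.discr K) (N : ℤ)) (hN : W.conductorNorm ℤ = N)
    (hH : SatisfiesHeegnerHypothesis N K)
    (hsplit : ((Ideal.span {(p : ℤ)}).primesOver (𝓞 K)).ncard = 2)
    {DK : WeierstrassCurve.PAdicHeightDataK W p K} (hDK : DK.IsCanonical)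
    {P : (W.baseChange K).toAffine.Point} (hP : IsHeegnerPoint N W K P)
    (hr : W.analyticRank = 1)
    (htw : (padicLFunction g (twistUnitRoot W p K)).order = 0) :
    DK.height P ≠ 0 := by
  have h1 : (padicLFunction f (unitRoot W p : ℚ_[p])).order = 1 := hcrux W p ⟨hgood, hord⟩ hr f hf
  have hK1 : (padicLFunctionEK W p K hf hg).order = 1 := by
    show (padicLFunction f (unitRoot W p : ℚ_[p]) * padicLFunction g (twistUnitRoot W p K)).order = 1
    rw [order_mul, h1, htw, add_zero]
  exact (h.order_eq_one_iff hf hg hp hgood hord hK hodd hcop hN hH hsplit hDK hP).mp hK1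

/-- `H_deg`: a DEGENERATE rank-one Heegner datum — a curve of analytic rank one, a split ordinary
`p ≥ 5`, a Heegner field with unit twist factor, and a Heegner point of canonical cyclotomic
`p`-adic height ZERO. Conjecturally EMPTY (Schneider 1982/85; Mazur–Stein–Tate 2006 Conj. 1.1);
no instance is known (see the module docstring). This is what a counterexample to the crux at
`p ≥ 5` must produce. -/
def ExistsDegenerateHeegnerDatum : Prop :=
  ∃ (W : WeierstrassCurve ℚ) (_ : W.IsElliptic) (_ : W.IsGloballyMinimal) (p : ℕ) (_ : Fact p.Prime)
    (K : Type) (_ : Field K) (_ : NumberField K) (N : ℕ) (_ : NeZero N)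
    (Nf Ng : ℕ) (_ : NeZero Nf) (_ : NeZero Ng) (f : CuspForm (Gamma0 Nf) 2) (g : CuspForm (Gamma0 Ng) 2)
    (_ : IsNewformOf W f) (_ : IsNewformOf (W.quadraticTwist (NumberField.discr K : ℚ)) g),
    5 ≤ p ∧ W.HasGoodReductionAtPrime p ∧ ¬ (p : ℤ) ∣ W.frobeniusTrace p ∧
    IsImaginaryQuadratic K ∧ Odd (NumberField.discr K) ∧
    IsCoprime (NumberField.discr K) (N : ℤ) ∧ W.conductorNorm ℤ = N ∧
    SatisfiesHeegnerHypothesis N K ∧ ((Ideal.span {(p : ℤ)}).primesOver (𝓞 K)).ncard = 2 ∧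
    W.analyticRank = 1 ∧ (padicLFunction g (twistUnitRoot W p K)).order = 0 ∧
    ∃ (DK : WeierstrassCurve.PAdicHeightDataK W p K) (_ : DK.IsCanonical)
      (P : (W.baseChange K).toAffine.Point) (_ : IsHeegnerPoint N W K P), DK.height P = 0

/-- (3b) **What a counterexample is**: modulo Perrin-Riou's theorem, a degenerate rank-one Heegner
datum refutes the crux. (NOT filed as a refutation modulo `H`: `H_deg` is conjecturally empty.)
[cite: PerrinRiou1987, Thm. 1.3] -/
theorem crux_false_of_degenerateHeegnerDatum (h : perrinRiou_padicGrossZagier)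
    (hH : ExistsDegenerateHeegnerDatum) : ¬ PAdicOrderRankOneR4 := by
  obtain ⟨W, _, _, p, _, K, _, _, N, _, Nf, Ng, _, _, f, g, hf, hg, hp, hgood, hord, hK, hodd, hcop,
    hN, hH, hsplit, hr, htw, DK, hDK, P, hP, h0⟩ := hH
  intro hcrux
  exact height_ne_zero_of_crux hcrux h hf hg hp hgood hord hK hodd hcop hN hH hsplit hDK hP hr htw h0

/-- (3b) **A counterexample has `ord_T L_p ≥ 3` — unconditionally, at ANY good ordinary `p`
(`p = 2` included).** The tree's parity theorem `stub_even_order_iff_even_analyticRank`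
(`p`-adic functional equation at any level and any `p`, + Rohrlich `padicLFunction_ne_zero_holds`)
gives `ord_T L_p ≡ r_an = 1 (mod 2)` with finite order, so `ord ≠ 1 ⇒ ord ≥ 3`. Numerically: a kill
needs `L_p'(0) = L_p''(0) = 0`, i.e. a vanishing `p`-adic regulator AND more — never seen.
(Landed form: `Negative/CounterexampleShape.lean`, `order_ne_one_iff_three_le_order`.)
[cite: GreenbergLNM1716, §5] -/
theorem three_le_order_of_counterexample {N : ℕ} [NeZero N] {f : CuspForm (Gamma0 N) 2}
    (hord : IsOrdinaryAt W p) (hf : IsNewformOf W f) (hr : W.analyticRank = 1)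
    (hne1 : (padicLFunction f (unitRoot W p : ℚ_[p])).order ≠ 1) :
    (3 : ℕ∞) ≤ (padicLFunction f (unitRoot W p : ℚ_[p])).order := by
  have hpar := Summit.BirchSwinnertonDyer.BirchSwinnertonDyer.Theorems.stub_even_order_iff_even_analyticRank
    W p hord f hf
  rw [hr] at hpar
  have hodd : ¬ Even (padicLFunction f (unitRoot W p : ℚ_[p])).order.toNat := by
    rw [hpar]; decide
  have hfin : (padicLFunction f (unitRoot W p : ℚ_[p])).order ≠ ⊤ := by
    rw [Ne, order_eq_top]; exact padicLFunction_ne_zero_holds (f := f) hord hf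
  generalize hq : (padicLFunction f (unitRoot W p : ℚ_[p])).order = q at *
  induction q using ENat.recTopCoe with
  | top => exact absurd rfl hfin
  | coe n =>
    simp only [ENat.toNat_coe] at hodd
    have hn1 : n ≠ 1 := fun h => hne1 (by rw [h]; rfl)
    have h3 : 3 ≤ n := by
      rcases Nat.even_or_odd n with he | ho
      · exact absurd he hodd
      · obtain ⟨k, rfl⟩ := ho; omega
    exact_mod_cast h3

/-- (3b') **The crux, pointwise, is `L_p'(E,0) ≠ 0`**: `1 ≤ order` is the landed stub S1
(`TameShadow.stub_one_le_order`), so `order = 1 ↔ coeff 1 ≠ 0`. This is the quantity the kit jobs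
certify non-zero pair by pair. [cite: MazurTateTeitelbaum1986Invent, §I.14 (14.3)] -/
theorem order_eq_one_iff_coeff_one_ne_zero {N : ℕ} [NeZero N] {f : CuspForm (Gamma0 N) 2}
    (hord : IsOrdinaryAt W p) (hf : IsNewformOf W f) (hr : W.analyticRank = 1) :
    (padicLFunction f (unitRoot W p : ℚ_[p])).order = 1 ↔
      coeff 1 (padicLFunction f (unitRoot W p : ℚ_[p])) ≠ 0 := by
  have h1 := Summit.BirchSwinnertonDyer.BirchSwinnertonDyer.Theorems.TameShadow.stub_one_le_order
    W p hord hr f hf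
  rw [show (1 : ℕ∞) = ((1 : ℕ) : ℕ∞) from rfl, order_eq_nat]
  constructor
  · exact fun h => h.1
  · intro h
    refine ⟨h, fun i hi => ?_⟩
    obtain rfl : i = 0 := by omega
    exact coeff_of_lt_order 0 (lt_of_lt_of_le (by exact_mod_cast Nat.zero_lt_one) h1)

end Consequences

/-! ## Computation (kit jobs of this seat; logs under the item's evidence `compute-j0165xx.json`)

* j016547 (PARI/GP 2.15.4, 115 s): 166 rank-one isogeny classes `N ≤ 330` × good ordinary
  `p ∈ {2,3,5,7}` = 351 pairs; overconvergent modular symbols (`msfromell`/`mspadicinit`/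
  `mspadicmoments`/`mspadicL`). `p = 3, 5, 7`: `L_p(0) = O(p^n)`, `L_p'(0) ≠ 0` in all 324 pairs.
  `p = 2`: 22 pairs with `a_2 = -1` all `L_p'(0) ≠ 0`; the 5 pairs with `a_2 = +1` printed
  `O(2^k)` for `L_p', L_p'', L_p'''` even at `n = 16` ("candidates").
* j016704 (2 s): the five `a_2 = +1` curves recomputed by the recipe OF THE TREE — exact rational plus
  symbols `[a/2^m]⁺` (`mseval`), `μ(a + 2^m) = α^{-m}[a/2^m]⁺ - α^{-(m+1)}[a/2^{m-1}]⁺`, Riemann sums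
  `Σ_{η=±1} Σ_{s<2^n} μ_{n+2}(η 5^s) C(s,k)` for `k ≤ 3`, `n = 5,7,9` (digits stable): `c₀ = O(2^39)`,
  `v₂(c₁) = 2,2,0,0,1` — NON-ZERO, so `ord_T L_2(E,T) = 1` for all five; controls: three `a_2 = -1`
  curves (`v₂(c₁) = 0,1,2`, matching PARI's values up to the factor `log_2 5`, valuation 2), three
  odd-`p` pairs (matching PARI up to `log_p(1+p)`), and four RANK-0 curves with `a_2 = +1` where PARI
  again printed `O(2^7)` but the Riemann sums give `c₀` of valuation `2·v(1-α⁻¹) + v([0]⁺)` exactly as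
  the interpolation formula predicts. VERDICT: PARI artefact at `p = 2`, `a_2 = +1` (`α ≡ 3 mod 4`);
  no counterexample anywhere in range.

## §4 Line `Sketch` (idea `tame-shadow-derived-kato`): the v1 stubs as filed at 10:35Z

Verbatim copies (2026-08-16T10:35Z, `Cruxes/PAdicOrderRankOneR4/Lines/Sketch.lean`, v1) of the line's
local vocabulary and of the statements of K1 `stub_shadowIdentity` and K2 `stub_shadowNonconstancy`,
so that the findings below are about the stubs EXACTLY as registered then. The lead's v2 skeleton
(same day, after wave 1) restricts K1 to `c₁ < m` and makes K2 produce `m > c₁`, which closes both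
escapes below; v2 also moves CM / non-surjective `ρ̄` to K3 (no Kolyvagin primes there). -/

namespace Line

/-- Verbatim copy of the line's `tameMsdMeasure`. [cite: MazurTateTeitelbaum1986Invent, §I.10 (10.1)] -/
def tameMsdMeasure {N : ℕ} (f : CuspForm (Gamma0 N) 2) {p : ℕ} [Fact p.Prime] (α : ℚ_[p]) (L m : ℕ)
    (a : ZMod (L * p ^ m)) : ℚ_[p] :=
  α⁻¹ ^ m * (ratPlusSymbol f ((a.val : ℚ) / ((L : ℚ) * (p : ℚ) ^ m)) : ℚ_[p]) -
    α⁻¹ ^ (m + 1) * (ratPlusSymbol f ((a.val : ℚ) / ((L : ℚ) * (p : ℚ) ^ (m - 1))) : ℚ_[p])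

/-- Verbatim copy of the line's `crtResidue`. [folklore] -/
def crtResidue (L : ℕ) {p : ℕ} (m : ℕ) (b : ZMod L) (c : ZMod (p ^ m)) : ZMod (L * p ^ m) :=
  if h : Nat.Coprime L (p ^ m) then (ZMod.chineseRemainder h).symm (b, c) else 0

/-- Verbatim copy of the line's `tameMixedCoeff`. [cite: MazurTateTeitelbaum1986Invent, §I.10 and §I.13] -/
def tameMixedCoeff {N : ℕ} (f : CuspForm (Gamma0 N) 2) {p : ℕ} [Fact p.Prime] (α : ℚ_[p]) (ℓ M : ℕ)
    (ψ : (ZMod ℓ)ˣ →* Multiplicative (ZMod (p ^ M))) (n j : ℕ) : ℚ_[p] :=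
  ∑ᶠ η : rootsOfUnity (torsionOrder p) ℤ_[p], ∑ s : ZMod (p ^ n), ∑ᶠ b : (ZMod ℓ)ˣ,
    tameMsdMeasure f α ℓ (n + cyclotomicExponent p)
        (crtResidue ℓ (n + cyclotomicExponent p) (b : ZMod ℓ)
          (PadicInt.toZModPow (n + cyclotomicExponent p) ((η : ℤ_[p]ˣ) : ℤ_[p]) *
            (cyclotomicGenerator p : ZMod (p ^ (n + cyclotomicExponent p))) ^ s.val)) *
      ((Multiplicative.toAdd (ψ b)).val : ℚ_[p]) * (s.val.choose j : ℚ_[p])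

/-- Verbatim copy of the line's `IsKolyvaginPrime`. [cite: RubinEulerSystems2000, §4.1 (Kolyvagin primes)] -/
def IsKolyvaginPrime (W : WeierstrassCurve ℚ) [W.IsGloballyMinimal] (p n ℓ : ℕ) : Prop :=
  ∃ _ : Fact ℓ.Prime, ℓ ≠ p ∧ W.HasGoodReductionAtPrime ℓ ∧ (p ^ n : ℤ) ∣ (ℓ : ℤ) - 1 ∧
    (p ^ n : ℤ) ∣ W.frobeniusTrace ℓ - (ℓ + 1) ∧
    Nat.card {P : ((WeierstrassCurve.integralModelInt W).map (Int.castRingHom (ZMod ℓ))).toAffine.Point //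
      p • P = 0} = p

/-- Verbatim copy of the line's `IsZModReduction`. [folklore] -/
def IsZModReduction {p : ℕ} [Fact p.Prime] (m : ℕ) (x : ZMod (p ^ m)) (y : ℚ_[p]) : Prop :=
  ∃ z : ℤ_[p], (z : ℚ_[p]) = y ∧ PadicInt.toZModPow m z = x

/-- **K1 as registered** (statement of `TameShadow.stub_shadowIdentity`, verbatim). -/
def K1stmt : Prop :=
    ∀ (W : WeierstrassCurve ℚ) [W.IsElliptic] [W.IsGloballyMinimal] (p : ℕ) [Fact p.Prime],
      5 ≤ p → IsOrdinaryAt W p → ¬ (p : ℤ) ∣ W.frobeniusTrace p - 1 → W.HasIrreducibleModPGaloisRep p →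
      W.analyticRank = 1 →
      ∀ {N : ℕ} [NeZero N] (f : CuspForm (Gamma0 N) 2), IsNewformOf W f →
      (2 : ℕ∞) ≤ (padicLFunction f (unitRoot W p : ℚ_[p])).order →
      ∃ c₀ d₀ c₁ : ℕ, ∀ d : ℕ, d₀ ≤ d → ∀ m : ℕ,
        ∃ u w : (ZMod (p ^ m))⟦X⟧,
          ¬ ((p : ZMod (p ^ m)) ^ c₁ ∣ constantCoeff u * constantCoeff w) ∧
          ∀ ℓ : ℕ, IsKolyvaginPrime W p (m + c₀ + 1) ℓ →
          ∀ ψ : (ZMod ℓ)ˣ →* Multiplicative (ZMod (p ^ (m + c₀))), Function.Surjective ψ →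
          ∀ b₀ b₁ : ZMod (p ^ m),
            IsZModReduction m b₀ ((p : ℚ_[p]) ^ d * tameMixedCoeff f (unitRoot W p : ℚ_[p]) ℓ (m + c₀) ψ (m + c₀) 0) →
            IsZModReduction m b₁ ((p : ℚ_[p]) ^ d * tameMixedCoeff f (unitRoot W p : ℚ_[p]) ℓ (m + c₀) ψ (m + c₀) 1) →
            ∃ (b t Rs S : (ZMod (p ^ m))⟦X⟧) (c : ZMod (p ^ m)),
              constantCoeff b = b₀ ∧ coeff 1 b = b₁ ∧
              C c * t * t.subst invOnePlusSubOne + u * b * w.subst invOnePlusSubOne +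
                  invOnePlusSubOne ^ 2 * Rs = X ^ 2 * S

/-- **K2 as registered** (statement of `TameShadow.stub_shadowNonconstancy`, verbatim). -/
def K2stmt : Prop :=
    ∀ (W : WeierstrassCurve ℚ) [W.IsElliptic] [W.IsGloballyMinimal] (p : ℕ) [Fact p.Prime],
      5 ≤ p → IsOrdinaryAt W p → ¬ (p : ℤ) ∣ W.frobeniusTrace p - 1 → W.HasIrreducibleModPGaloisRep p →
      W.analyticRank = 1 →
      ∀ {N : ℕ} [NeZero N] (f : CuspForm (Gamma0 N) 2), IsNewformOf W f →
      ∀ c₀ d₀ c₁ : ℕ, ∃ d : ℕ, d₀ ≤ d ∧ ∃ m : ℕ,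
        ∀ V₀ V₁ : ZMod (p ^ m), ¬ ((p : ZMod (p ^ m)) ^ c₁ ∣ V₀) →
          ∃ ℓ : ℕ, IsKolyvaginPrime W p (m + c₀ + 1) ℓ ∧
          ∃ ψ : (ZMod ℓ)ˣ →* Multiplicative (ZMod (p ^ (m + c₀))), Function.Surjective ψ ∧
          ∃ b₀ b₁ : ZMod (p ^ m),
            IsZModReduction m b₀ ((p : ℚ_[p]) ^ d * tameMixedCoeff f (unitRoot W p : ℚ_[p]) ℓ (m + c₀) ψ (m + c₀) 0) ∧
            IsZModReduction m b₁ ((p : ℚ_[p]) ^ d * tameMixedCoeff f (unitRoot W p : ℚ_[p]) ℓ (m + c₀) ψ (m + c₀) 1) ∧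
            V₀ * b₁ ≠ b₀ * V₁

/-- In `ZMod (p^0)` (a one-element ring) every divisibility holds. [folklore] -/
theorem dvd_of_level_zero (p : ℕ) (c : ℕ) (x : ZMod (p ^ 0)) : (p : ZMod (p ^ 0)) ^ c ∣ x := by
  haveI : Subsingleton (ZMod (p ^ 0)) := ZMod.subsingleton_iff.2 (pow_zero p)
  exact ⟨0, Subsingleton.elim _ _⟩

/-- **K2 is trivially TRUE** (stub-misstated): witness `d = d₀`, `m = 0`; the guard
`¬ (p^c₁ ∣ V₀)` is unsatisfiable in `ZMod (p^0)`, so the `∀ V₀ V₁` clause is vacuous. No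
Kolyvagin prime, no `tameMixedCoeff`, no hypothesis is touched. Repair: `∃ m, c₁ < m ∧ …`. -/
theorem K2_trivial : K2stmt := by
  intro W _ _ p _ hp hord hna hirr hr N _ f hf c₀ d₀ c₁
  exact ⟨d₀, le_rfl, 0, fun V₀ V₁ hV => absurd (dvd_of_level_zero p c₁ V₀) hV⟩

/-- The open half of the crux on the line's MAIN RANGE (`5 ≤ p`, non-anomalous, `E[p]`
irreducible): `r_an = 1 ⟹ ord_T L_p < 2`. -/
def UpperHalfMainRange : Prop :=
  ∀ (W : WeierstrassCurve ℚ) [W.IsElliptic] [W.IsGloballyMinimal] (p : ℕ) [Fact p.Prime],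
    5 ≤ p → IsOrdinaryAt W p → ¬ (p : ℤ) ∣ W.frobeniusTrace p - 1 → W.HasIrreducibleModPGaloisRep p →
    W.analyticRank = 1 →
    ∀ {N : ℕ} [NeZero N] (f : CuspForm (Gamma0 N) 2), IsNewformOf W f →
      ¬ (2 : ℕ∞) ≤ (padicLFunction f (unitRoot W p : ℚ_[p])).order

/-- **K1 is the crux in costume** (stub-misstated): its conclusion is unsatisfiable (instantiate
`d = d₀`, `m = 0`: `¬ (p^c₁ ∣ u₀ w₀)` fails in `ZMod (p^0)`), so K1 is EQUIVALENT to
`UpperHalfMainRange`, the open `≤ 1` half of the crux on the main range. With K2 vacuous, the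
composition `PAdicOrderRankOneR4_of` therefore reduces the crux to itself (+ S1 + K3). Repair:
`∀ m, c₁ < m → ∃ u w, …` (then `¬ (p^c₁ ∣ u₀w₀)` is a genuine `p`-adic valuation bound). -/
theorem K1_iff_upperHalf : K1stmt ↔ UpperHalfMainRange := by
  constructor
  · intro hK1 W _ _ p _ hp hord hna hirr hr N _ f hf h2
    obtain ⟨c₀, d₀, c₁, H⟩ := hK1 W p hp hord hna hirr hr f hf h2
    obtain ⟨u, w, huw, -⟩ := H d₀ le_rfl 0
    exact huw (dvd_of_level_zero p c₁ _)
  · intro hU W _ _ p _ hp hord hna hirr hr N _ f hf h2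
    exact absurd h2 (hU W p hp hord hna hirr hr f hf)

/-- **Joint sufficiency check**: as filed, `K1 ∧ K2` proves `UpperHalfMainRange` for the trivial
reason that K1 alone is it. (The lead's `not_two_le_order_of_shadow` is sound; the point is that
no content flows through K2/P1.) -/
theorem upperHalf_of_K1 (hK1 : K1stmt) : UpperHalfMainRange := K1_iff_upperHalf.mp hK1

/- NOTE (line dead, 2026-08-16, `Lines/Sketch-dead.md`): after the `m`-repair the lead REFUTED K2 on
every instance of its hypotheses by Fricke/functional-equation rigidity — at every Kolyvagin prime
`2·b₁ + s̃(N)·b₀ = 0` in `ZMod (p^m)`, so the wild×tame ratio is frozen at `-s̃(N)/2` whatever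
`ord_T L_p` is, and K1's proportionality is satisfied trivially (`V₀ = 2`, `V₁ = -s̃(N)`). The
remark that K1's identity carries content only in its `X⁰, X¹` coefficients (orders `≥ 2` absorbed by
`S`; P1 = the `X¹` coefficient, landed p96992) is kept here as prose only. Recommended Negative lemma
for a re-armed disprover (lead's request): `tameShadow_rigidity` — the frozen relation itself, from
the tree theorems `IsFrickeEigen.normalizedPlusSymbol_div_eq_mul`, `rootNumber_eq_neg_frickeEigenvalue`,
`finsum_sum_classes_eq_mul_of_symmetry`, `sum_fiber_msdMeasure_succ_eq`. -/

end Line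

/-! ## §5 Near-misses and what was NOT achieved (for the next seat)

* No unconditional `¬ PAdicOrderRankOneR4`: impossible in the tree without a constructible newform
  (see module docstring). All refutation shapes here are `H → ¬ …` with `H` an existence statement.
* Line `Sketch` is DEAD (lead, Fricke rigidity kills K2); the first target of a re-armed disprover is
  the lead's recommended Negative lemma `tameShadow_rigidity` (see the note closing §4), which would
  pre-empt every future "first tame derivative" detector. This file is sorry-free.
* `p = 2, 3`: admitted by the crux; nothing in the tree or in print singles them out as false
  (the MSD construction and the tree's `unitRoot`/`cyclotomicGenerator` are honest at `p = 2`);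
  Kato/IMC/Perrin-Riou inputs need `p` odd resp. `p ≥ 5`, so a PROOF there is further away, but a
  kill there would be classed misstated (route kill-criterion (c), repair `5 ≤ p →`). The kit job
  j016547 targets exactly these primes numerically.
-/

end Summit.BirchSwinnertonDyer.BirchSwinnertonDyer.Cruxes.PAdicOrderRankOneR4.Disproof

end
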